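import Summits.HodgeConjecture.HodgeConjecture.Theorems.F0LD1ThetaArchCompactStep
import HarnessLib

-- statements over the theta-kernel datum elaborate to very large types; elaborate sequentially (as in the ★ kit lineage)
set_option Elab.async false

/-!
# (Gα-C∞, box step) A ONE-PLACE archimedean element acts on a Hermite theta class through ANY operator that reads Folland's section on the
# first box slot («box identity» as a HYPOTHESIS); the torus projector then EXTRACTS the Folland-frame Hermite coefficient of the image
# (line LD1 of crux HLiu418, brick (Gα-C∞) `ArchLadder`; the hypothesis-form twin of ★ `F0LD1ThetaArchCompactStep` §2–§4, serving the ι-step (P4) of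
# LD1-p02 (g4), whose box identity at the non-compact boost is ★ `sectionD_archKPlace_apply_of_boost` + ★ `…ArchPlaceBoxOperators` ∕ `…ArchPlaceBoxLevi`)

Cell hodgecm-mathlib, floor 0; namespace `Summit.HodgeConjecture.HodgeConjecture.Cruxes.HLiu418.F0LD1ThetaArchBoxStep`; seat A-p13 (g40) (second hand of
LD1-p02 (g4), LD1-plan (g2) DEALS #12 (1)); `--supports stmt-HodgeConjecture-24832 --as helper`.  THEOREMS ONLY (no definition, no instance, no notation,
no `sorry`).

THE POINT.  ★ `F0LD1ThetaArchCompactStep` (A-p16 (g35), plate (P1)) reads `R(k)`, `ιA k = adelicSingle w₀ u`, on `[θ_{h_β ⊗ Φ_f}]` for `u` COMPACT at a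
POSITIVE place, deriving the box identity from ★ β-I∕β-II.  At the MIXED place `ι` the element is a non-compact boost and the box identity comes from a
different road ((P4a)–(P4c) of LD1-p02 (g4)); this file therefore takes the box identity itself as the hypothesis
`hbox : carrierConjEquiv frameD (sectionD k_{v₀,u}) (R_{e₂}(h^V_β ⊠ h^V_0)) = c • R_{e₂}(φ′ ⊠ h^V_0)` (ANY `u` at ANY real place `v₀`, ANY image `φ′`, ANY
scalar `c`) — exactly the `hS` of ★ T2 `pairRep_chiSplittingLine_adelicSingle_tmul_of_box` — and repeats §2–§4 verbatim otherwise: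
* §1 **`rightRegular_toLp_lineThetaLift_follandHermite_of_box`**: `R(k) [θ_{h_β ⊗ Φ_f}] = (η_D(u) · c) • [θ_{φ′ ⊗ Φ_f}]` (★ K1 `rightRegular_toLp_lineThetaLift`
  + ★ T2; `Φ_f = 0` trivially).
* §2 **`charProjL_rightRegular_thetaClass_follandHermite_of_box`**: the full-torus projector of type `c_γ` sends `R(k) [θ_{h_β ⊗ Φ_f}]` to
  `(η_D(u) · c · c_γ(φ′)) • [θ_{h_γ ⊗ Φ_f}]`, `c_γ(φ′) = hermiteCoeff γ ((euclE^*)⁻¹ (frameV^* φ′))` the Folland-frame Hermite coefficient (★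
  `charProjL_thetaClass_eq_coeff_smul_of_hasSum_thetaClass` fed by ★ `hasSum_follandCoeff_smul_thetaClass_follandHermite`).
* §3 **`thetaClass_follandHermite_mem_of_box_of_coeff_ne_zero`** — THE BOX STEP of the ladder: if `Q` is a closed `R`-invariant subspace,
  `[θ_{h_β ⊗ Φ_f}] ∈ Q`, `c ≠ 0` and `c_γ(φ′) ≠ 0`, then `[θ_{h_γ ⊗ Φ_f}] ∈ Q` (★ `charProj_restrict_mem_closedSubrep`; `η_D(u) ∈ ℂˣ`).
For the ι-step: `φ′ := A_t h^V_β`, `A_t` the reindexed boost operator, `c := vac ∕ vacCoeffS ≠ 0` (★ P4a), `c_{β ± d}(A_t h_β) ≠ 0` for some `t` (★ P4d ∕ ★ p851122).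
Nothing printed is discharged; HC_CM is proved only modulo the 7 printed citations (2 remaining: hLiu418 = stmt-HodgeConjecture-24832, h413 =
stmt-HodgeConjecture-24833) until rung 0 closes; count-neutral.

References (prose locators): Folland 1989 §1.7 (1.81), §4.2 (4.23)–(4.24), Prop. (4.39); Konno–Konno 2007 §3.3, Thm. 5.4; Kashiwara–Vergne 1978 §6;
Howe 1989 §3; Bröcker–tom Dieck 1985 III (5.10); Borel–Jacquet 1979 §4.6.
-/

set_option autoImplicit false
set_option linter.dupNamespace false

noncomputable section

open NumberField NumberField.InfinitePlace MeasureTheory IsDedekindDomain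
open scoped Matrix ComplexOrder ENNReal TensorProduct SchwartzMap Kronecker Classical ComplexConjugate InnerProductSpace

namespace Summit.HodgeConjecture.HodgeConjecture.Cruxes.HLiu418.F0LD1ThetaArchBoxStep

open _root_.MeasureTheory
open Literature.NumberTheory.Automorphic Literature.NumberTheory.Automorphic.UnitaryGroup
open Literature.NumberTheory.Automorphic.UnitaryGroup.CotangentForms
open Literature.NumberTheory.Automorphic.IdeleClassGroup
open Literature.NumberTheory.Automorphic.Liu2021
open Literature.NumberTheory.Automorphic.Liu2021.Def411WeilCarriers
open Literature.NumberTheory.Automorphic.Liu2021.Def411WeilCarriersDoubling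
open Literature.NumberTheory.Automorphic.Liu2021.CinfThetaTorus
open Literature.NumberTheory.GelbartRogawski1991 Literature.NumberTheory.GelbartRogawski1991.UnitaryDualPair
open Literature.NumberTheory.GelbartRogawski1991.GRConstruction
open Literature.NumberTheory.Weil1964
open Literature.RepresentationTheory.Liu2021
open Literature.RepresentationTheory.HeisenbergGroup Literature.Analysis.SegalBargmann
open Literature.RepresentationTheory.KonnoKonno2007 Literature.RepresentationTheory.KonnoKonno2007.RealDualPair
open Literature.RepresentationTheory.CompactGroups
open Summit.HodgeConjecture.HodgeConjecture.Cruxes.HLiu418.F0LD1ThetaTransportKit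
open Summit.HodgeConjecture.HodgeConjecture.Cruxes.HLiu418.F0LD2ThetaTensorClasses
open Summit.HodgeConjecture.HodgeConjecture.Cruxes.HLiu418.F0LD2ThetaTorusEigenclass
open Summit.HodgeConjecture.HodgeConjecture.Cruxes.HLiu418.F0LD1ArchTorusHom
open Summit.HodgeConjecture.HodgeConjecture.Cruxes.HLiu418.F0LD1ThetaClassTorusExtraction
open Summit.HodgeConjecture.HodgeConjecture.Cruxes.HLiu418.F0LD1ThetaClassHermiteSum
open Summit.HodgeConjecture.HodgeConjecture.Cruxes.HLiu418.F0LD1ThetaSliceTorusProjector (charProj_restrict_mem_closedSubrep)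

section Covariance


variable (L : Type) [Field L] [NumberField L] [IsCMField L] (N : ℕ) (H : Matrix (Fin N) (Fin N) L)
  {n' : ℕ} (e₁ : Fin N × Fin 1 ≃ Fin n') (dV : Fin N → L) (hdV : ∀ i, IsCMField.complexConj L (dV i) = dV i)
  (hdV0 : ∀ i, dV i ≠ 0)
  (ιA : (adelicGroupData (↥(maximalRealSubfield L)) L (IsCMField.complexConj L) N H).Adelic →*
    ↥(UnitaryGroup.adelic (↥(maximalRealSubfield L)) L (IsCMField.complexConj L) N (Matrix.diagonal dV)))
  (hιA : Continuous ιA ∧ ∀ ⦃γ : (adelicGroupData (↥(maximalRealSubfield L)) L (IsCMField.complexConj L) N H).Adelic⦄,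
    γ ∈ (UnitaryGroup.toAdelic (↥(maximalRealSubfield L)) L (IsCMField.complexConj L) N H).range →
      ιA γ ∈ (UnitaryGroup.toAdelic (↥(maximalRealSubfield L)) L (IsCMField.complexConj L) N (Matrix.diagonal dV)).range)
  (μ : Literature.NumberTheory.Automorphic.IdeleClassGroup L →ₜ* Circle) (hμ : IsConjugateSymplectic L μ) (a : (↥(maximalRealSubfield L))ˣ)
  (hρ : HasThetaMajorants fun
      (p : ↥(UnitaryGroup.adelic (↥(maximalRealSubfield L)) L (IsCMField.complexConj L) N (Matrix.diagonal dV)) ×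
        ↥(UnitaryGroup.adelic (↥(maximalRealSubfield L)) L (IsCMField.complexConj L) 1 (JW (↥(maximalRealSubfield L)) L a)))
      (Φ : piSchwartzBruhat (↥(maximalRealSubfield L)) (Fin n')) =>
        pairRep (↥(maximalRealSubfield L)) L (IsCMField.complexConj L) N 1 e₁ (Matrix.diagonal dV) (JW (↥(maximalRealSubfield L)) L a)
          (chiSplittingLine L e₁ dV hdV hdV0 (toHeckeCharacter L μ) (isUnitary_toHeckeCharacter L μ)
            ((isOscillatorChar_toHeckeCharacter_iff μ).mpr hμ) (TW (↥(maximalRealSubfield L)) a)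
            (isUnit_det_TW (↥(maximalRealSubfield L)) a) (JW (↥(maximalRealSubfield L)) L a) (JW_eq (↥(maximalRealSubfield L)) L a))
          p Φ)
  [CompactSpace (↥(UnitaryGroup.adelic (↥(maximalRealSubfield L)) L (IsCMField.complexConj L) N (Matrix.diagonal dV)) ⧸
    (UnitaryGroup.toAdelic (↥(maximalRealSubfield L)) L (IsCMField.complexConj L) N (Matrix.diagonal dV)).range)]
  [MeasurableSpace (↥(UnitaryGroup.adelic (↥(maximalRealSubfield L)) L (IsCMField.complexConj L) 1 (JW (↥(maximalRealSubfield L)) L a)) ⧸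
    (UnitaryGroup.toAdelic (↥(maximalRealSubfield L)) L (IsCMField.complexConj L) 1 (JW (↥(maximalRealSubfield L)) L a)).range)]
  (μW : Measure (↥(UnitaryGroup.adelic (↥(maximalRealSubfield L)) L (IsCMField.complexConj L) 1 (JW (↥(maximalRealSubfield L)) L a)) ⧸
    (UnitaryGroup.toAdelic (↥(maximalRealSubfield L)) L (IsCMField.complexConj L) 1 (JW (↥(maximalRealSubfield L)) L a)).range))
  (f : C((↥(UnitaryGroup.adelic (↥(maximalRealSubfield L)) L (IsCMField.complexConj L) 1 (JW (↥(maximalRealSubfield L)) L a)) ⧸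
    (UnitaryGroup.toAdelic (↥(maximalRealSubfield L)) L (IsCMField.complexConj L) 1 (JW (↥(maximalRealSubfield L)) L a)).range), ℂ))
  [BorelSpace (↥(UnitaryGroup.adelic (↥(maximalRealSubfield L)) L (IsCMField.complexConj L) 1 (JW (↥(maximalRealSubfield L)) L a)) ⧸
    (UnitaryGroup.toAdelic (↥(maximalRealSubfield L)) L (IsCMField.complexConj L) 1 (JW (↥(maximalRealSubfield L)) L a)).range)]
  [IsFiniteMeasure μW]
  [CompactSpace (adelicGroupData (↥(maximalRealSubfield L)) L (IsCMField.complexConj L) N H).automorphicQuotient]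
  (ν : Measure (adelicGroupData (↥(maximalRealSubfield L)) L (IsCMField.complexConj L) N H).automorphicQuotient) [IsFiniteMeasure ν]
  [SMulInvariantMeasure (adelicGroupData (↥(maximalRealSubfield L)) L (IsCMField.complexConj L) N H).Adelic
    (adelicGroupData (↥(maximalRealSubfield L)) L (IsCMField.complexConj L) N H).automorphicQuotient ν]

include hιA

set_option maxHeartbeats 1600000 in
-- (the line telescope of ★ T2 is large; the rewrites are few — as ★ `F0LD1ThetaArchCompactStep` §2)
/-- **§1 A ONE-PLACE ELEMENT ACTS ON A HERMITE THETA CLASS THROUGH ITS BOX IDENTITY.**  Let `v₀` be ANY real place of `L⁺`, `w₀ = cmPlaceOver L v₀`,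
`u ∈ U(σ_{w₀} diag dV)(ℂ)` ANY element, `k ∈ U(H)(𝔸)` with `ιA k = adelicSingle w₀ u`, and suppose Folland's section at `k_{v₀,u}` reads on the first box slot as
`hbox : frameD^* sectionD(k_{v₀,u}) (frameD^*)⁻¹ (R_{e₂}(h^V_β ⊠ h^V_0)) = c • R_{e₂}(φ′ ⊠ h^V_0)`.  Then
`R(k) [Θ̃_{E(h^V_β ⊗ Φ_f)}(f) ∘ ιA] = (η_D(u) · c) • [Θ̃_{E(φ′ ⊗ Φ_f)}(f) ∘ ιA]` in `L²([U(H)], ν)` (★ K1 `rightRegular_toLp_lineThetaLift` + ★ T2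
`pairRep_chiSplittingLine_adelicSingle_tmul_of_box`). [cite: Folland1989, §4.2 (4.23), Prop. (4.39)] [cite: KonnoKonno2007, §3.3, Thm. 5.4] [cite: BorelJacquet1979, §4.1, §4.6] -/
theorem rightRegular_toLp_lineThetaLift_follandHermite_of_box (v₀ : {v : InfinitePlace (↥(maximalRealSubfield L)) // v.IsReal})
    {τ : InfinitePlace L → ℤ} (hτ : (toHeckeCharacter L μ).HasUnitaryArchType τ 0) (hodd : ∀ w, Odd (τ w))
    (u : UnitaryGroup.archLocal L N (Matrix.diagonal dV) (cmPlaceOver L v₀))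
    (β : (Fin n' × {v : InfinitePlace (↥(maximalRealSubfield L)) // v.IsReal}) →₀ ℕ)
    {φ' : 𝓢((Fin n' → mixedEmbedding.mixedSpace ↥(maximalRealSubfield L)), ℂ)} {c : ℂ}
    (hbox : carrierConjEquiv (frameD L e₁ dV hdV hdV0 (lineW L (TW (Fp L) a)) (complexConj_lineW L (TW (Fp L) a)) (lineW_ne_zero L (TW (Fp L) a) (isUnit_det_TW (Fp L) a))) (sectionD L e₁ dV hdV hdV0 (lineW L (TW (Fp L) a)) (complexConj_lineW L (TW (Fp L) a)) (lineW_ne_zero L (TW (Fp L) a) (isUnit_det_TW (Fp L) a)) (archKPlace L e₁ dV hdV (lineW L (TW (Fp L) a)) (complexConj_lineW L (TW (Fp L) a)) v₀ u)).1.2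
        (schwartzReindexCLM (Fp L) (e₂ (n := n')) (archBoxTensor (follandHermite (frameV L e₁ dV hdV hdV0 (lineW L (TW (Fp L) a)) (complexConj_lineW L (TW (Fp L) a)) (lineW_ne_zero L (TW (Fp L) a) (isUnit_det_TW (Fp L) a))) β) (follandHermite (frameV L e₁ dV hdV hdV0 (lineW L (TW (Fp L) a)) (complexConj_lineW L (TW (Fp L) a)) (lineW_ne_zero L (TW (Fp L) a) (isUnit_det_TW (Fp L) a))) 0))) =
      c • schwartzReindexCLM (Fp L) (e₂ (n := n')) (archBoxTensor φ' (follandHermite (frameV L e₁ dV hdV hdV0 (lineW L (TW (Fp L) a)) (complexConj_lineW L (TW (Fp L) a)) (lineW_ne_zero L (TW (Fp L) a) (isUnit_det_TW (Fp L) a))) 0)))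
    (k : (adelicGroupData (↥(maximalRealSubfield L)) L (IsCMField.complexConj L) N H).Adelic)
    (hk : ιA k = UnitaryGroup.adelicSingle (↥(maximalRealSubfield L)) L (IsCMField.complexConj L) N (Matrix.diagonal dV) (IsCMField.complexConj_ne_one L)
      (complexConj_smul_infinitePlace L) (cmPlaceOver L v₀) u)
    (Φf : FinSB (↥(maximalRealSubfield L)) (Fin n')) :
    (adelicGroupData (↥(maximalRealSubfield L)) L (IsCMField.complexConj L) N H).rightRegular ν k
        (MemLp.toLp _ (memLp_toQuotFun_lineThetaLift L N H e₁ dV hdV hdV0 ιA hιA μ hμ a hρ μW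
          (piSchwartzBruhatEquiv (↥(maximalRealSubfield L)) (Fin n') ((follandHermite (frameV L e₁ dV hdV hdV0 (lineW L (TW (Fp L) a)) (complexConj_lineW L (TW (Fp L) a)) (lineW_ne_zero L (TW (Fp L) a) (isUnit_det_TW (Fp L) a))) β) ⊗ₜ Φf)) f ν 2)) =
      ((((etaD L e₁ dV hdV (lineW L (TW (Fp L) a)) (complexConj_lineW L (TW (Fp L) a)) τ (archKPlace L e₁ dV hdV (lineW L (TW (Fp L) a)) (complexConj_lineW L (TW (Fp L) a)) v₀ u) : ℂˣ) : ℂ)) * c) •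
        MemLp.toLp _ (memLp_toQuotFun_lineThetaLift L N H e₁ dV hdV hdV0 ιA hιA μ hμ a hρ μW
          (piSchwartzBruhatEquiv (↥(maximalRealSubfield L)) (Fin n') (φ' ⊗ₜ Φf)) f ν 2) := by
  -- the equivariance of the class along `ιA`
  have hE := rightRegular_toLp_lineThetaLift L N H e₁ dV hdV hdV0 ιA hιA μ hμ a hρ μW
    (piSchwartzBruhatEquiv (Fp L) (Fin n') ((follandHermite (frameV L e₁ dV hdV hdV0 (lineW L (TW (Fp L) a)) (complexConj_lineW L (TW (Fp L) a)) (lineW_ne_zero L (TW (Fp L) a) (isUnit_det_TW (Fp L) a))) β) ⊗ₜ Φf)) f ν k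
  rw [hk] at hE
  by_cases hΦf : Φf = 0
  · -- trivial case `Φ_f = 0`: both sides are `0`
    subst hΦf
    rw [TensorProduct.tmul_zero, TensorProduct.tmul_zero, map_zero, ← zero_smul ℂ (0 : piSchwartzBruhat (Fp L) (Fin n')),
      toLp_lineThetaLift_smul_left L N H e₁ dV hdV hdV0 ιA hιA μ hμ a hρ μW f ν, zero_smul, map_zero, smul_zero]
  have hne : piSchwartzBruhatEquiv (Fp L) (Fin n') ((follandHermite (frameV L e₁ dV hdV hdV0 (lineW L (TW (Fp L) a)) (complexConj_lineW L (TW (Fp L) a)) (lineW_ne_zero L (TW (Fp L) a) (isUnit_det_TW (Fp L) a))) 0) ⊗ₜ Φf) ≠ 0 :=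
    piSchwartzBruhatEquiv_tmul_ne_zero (gaussianV_ne_zero L e₁ dV hdV hdV0 _ _ _) hΦf
  have hT2 := pairRep_chiSplittingLine_adelicSingle_tmul_of_box L dV hdV hdV0 v₀ e₁ (isUnitary_toHeckeCharacter L μ)
    ((isOscillatorChar_toHeckeCharacter_iff μ).mpr hμ) hτ hodd (TW (Fp L) a) (isUnit_det_TW (Fp L) a) (JW (Fp L) L a) (JW_eq (Fp L) L a) u hbox Φf hne
  rw [toLp_lineThetaLift_congr L N H e₁ dV hdV hdV0 ιA hιA μ hμ a hρ μW f ν hT2,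
    toLp_lineThetaLift_smul_left L N H e₁ dV hdV hdV0 ιA hιA μ hμ a hρ μW f ν] at hE
  exact hE

set_option maxHeartbeats 1600000 in
/-- **§2 THE FULL-TORUS PROJECTOR EXTRACTS THE FOLLAND-FRAME HERMITE COEFFICIENT OF THE IMAGE**: with `P_γ = Schur.charProjL μT κ_γ ((rightRegular ν).restrict kT)` the
character projector of the ★ torus hom `kT` (`hkT`, ★ `F0LD1ArchTorusHom`) and the one-dimensional unitary `κ_γ` of type `c_γ` (`hκc`), and `k`, `u`, `hbox` as in §1:
`P_γ (R(k) [θ_{h_β ⊗ Φ_f}]) = (η_D(u) · c · c_γ(φ′)) • [θ_{h_γ ⊗ Φ_f}]`, `c_γ(φ′) = hermiteCoeff γ ((euclE^*)⁻¹ (frameV^* φ′))` (§1, ★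
`charProjL_thetaClass_eq_coeff_smul_of_hasSum_thetaClass` fed by ★ `hasSum_follandCoeff_smul_thetaClass_follandHermite` on `φ′`).
[cite: BrockerTomDieck1985, III (5.10)] [cite: Folland1989, §1.7 (1.81), Prop. (4.39)] [cite: KonnoKonno2007, Thm. 5.4] -/
theorem charProjL_rightRegular_thetaClass_follandHermite_of_box (v₀ : {v : InfinitePlace (↥(maximalRealSubfield L)) // v.IsReal})
    {τ : InfinitePlace L → ℤ} (hτ : (toHeckeCharacter L μ).HasUnitaryArchType τ 0) (hodd : ∀ w, Odd (τ w))
    (u : UnitaryGroup.archLocal L N (Matrix.diagonal dV) (cmPlaceOver L v₀))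
    (β γ : (Fin n' × {v : InfinitePlace (↥(maximalRealSubfield L)) // v.IsReal}) →₀ ℕ)
    {φ' : 𝓢((Fin n' → mixedEmbedding.mixedSpace ↥(maximalRealSubfield L)), ℂ)} {c : ℂ}
    (hbox : carrierConjEquiv (frameD L e₁ dV hdV hdV0 (lineW L (TW (Fp L) a)) (complexConj_lineW L (TW (Fp L) a)) (lineW_ne_zero L (TW (Fp L) a) (isUnit_det_TW (Fp L) a))) (sectionD L e₁ dV hdV hdV0 (lineW L (TW (Fp L) a)) (complexConj_lineW L (TW (Fp L) a)) (lineW_ne_zero L (TW (Fp L) a) (isUnit_det_TW (Fp L) a)) (archKPlace L e₁ dV hdV (lineW L (TW (Fp L) a)) (complexConj_lineW L (TW (Fp L) a)) v₀ u)).1.2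
        (schwartzReindexCLM (Fp L) (e₂ (n := n')) (archBoxTensor (follandHermite (frameV L e₁ dV hdV hdV0 (lineW L (TW (Fp L) a)) (complexConj_lineW L (TW (Fp L) a)) (lineW_ne_zero L (TW (Fp L) a) (isUnit_det_TW (Fp L) a))) β) (follandHermite (frameV L e₁ dV hdV hdV0 (lineW L (TW (Fp L) a)) (complexConj_lineW L (TW (Fp L) a)) (lineW_ne_zero L (TW (Fp L) a) (isUnit_det_TW (Fp L) a))) 0))) =
      c • schwartzReindexCLM (Fp L) (e₂ (n := n')) (archBoxTensor φ' (follandHermite (frameV L e₁ dV hdV hdV0 (lineW L (TW (Fp L) a)) (complexConj_lineW L (TW (Fp L) a)) (lineW_ne_zero L (TW (Fp L) a) (isUnit_det_TW (Fp L) a))) 0)))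
    (k : (adelicGroupData (↥(maximalRealSubfield L)) L (IsCMField.complexConj L) N H).Adelic)
    (hk : ιA k = UnitaryGroup.adelicSingle (↥(maximalRealSubfield L)) L (IsCMField.complexConj L) N (Matrix.diagonal dV) (IsCMField.complexConj_ne_one L)
      (complexConj_smul_infinitePlace L) (cmPlaceOver L v₀) u)
    (Φf : FinSB (↥(maximalRealSubfield L)) (Fin n'))
    (kT : (({v : InfinitePlace (↥(maximalRealSubfield L)) // v.IsReal}) → Fin N → Circle) →*
      (adelicGroupData (↥(maximalRealSubfield L)) L (IsCMField.complexConj L) N H).Adelic)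
    (hkT : ∀ (v : {v : InfinitePlace (↥(maximalRealSubfield L)) // v.IsReal}) (x : Fin N → Circle),
      ιA (kT (Pi.mulSingle v x)) = UnitaryGroup.adelicSingle (↥(maximalRealSubfield L)) L (IsCMField.complexConj L) N (Matrix.diagonal dV)
        (IsCMField.complexConj_ne_one L) (complexConj_smul_infinitePlace L) (cmPlaceOver L v)
        ⟨circleDiagonal N x, circleDiagonal_mem_archLocal_diagonal L N dV (cmPlaceOver L v) x⟩)
    [MeasurableSpace (({v : InfinitePlace (↥(maximalRealSubfield L)) // v.IsReal}) → Fin N → Circle)] [BorelSpace (({v : InfinitePlace (↥(maximalRealSubfield L)) // v.IsReal}) → Fin N → Circle)]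
    (μT : Measure (({v : InfinitePlace (↥(maximalRealSubfield L)) // v.IsReal}) → Fin N → Circle)) [IsProbabilityMeasure μT] [μT.IsMulLeftInvariant]
    {κ : ContRepresentation ℂ (({v : InfinitePlace (↥(maximalRealSubfield L)) // v.IsReal}) → Fin N → Circle) ℂ}
    (hκ : Continuous (κ : (({v : InfinitePlace (↥(maximalRealSubfield L)) // v.IsReal}) → Fin N → Circle) → ℂ →L[ℂ] ℂ)) [κ.toRepresentation.IsIrreducible]
    (hκu : ∀ (g : (({v : InfinitePlace (↥(maximalRealSubfield L)) // v.IsReal}) → Fin N → Circle)) (x y : ℂ), ⟪κ g x, κ g y⟫_ℂ = ⟪x, y⟫_ℂ)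
    (hκc : ∀ z, κ z 1 = (∏ v : {v : InfinitePlace (↥(maximalRealSubfield L)) // v.IsReal}, ∏ p : Fin N, (((z v p : Circle) : ℂ)) ^
        (if 0 < signVec (cmPlaceOver L) (cmGramEntry L e₁ dV hdV (lineW L (TW (Fp L) a)) (complexConj_lineW L (TW (Fp L) a))) (imagUnit L) v (e₁ (p, 0))
          then (τ (cmPlaceOver L v).1 + 1) / 2 + γ (e₁ (p, 0), v)
          else (τ (cmPlaceOver L v).1 + 1) / 2 - 1 - γ (e₁ (p, 0), v))))
    (hU : ∀ w, Continuous fun z : (({v : InfinitePlace (↥(maximalRealSubfield L)) // v.IsReal}) → Fin N → Circle) => (((adelicGroupData (↥(maximalRealSubfield L)) L (IsCMField.complexConj L) N H).rightRegular ν).restrict kT) z w)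
    (hUu : ∀ (z : (({v : InfinitePlace (↥(maximalRealSubfield L)) // v.IsReal}) → Fin N → Circle)) (w w' : Lp ℂ 2 ν), ⟪(((adelicGroupData (↥(maximalRealSubfield L)) L (IsCMField.complexConj L) N H).rightRegular ν).restrict kT) z w, (((adelicGroupData (↥(maximalRealSubfield L)) L (IsCMField.complexConj L) N H).rightRegular ν).restrict kT) z w'⟫_ℂ = ⟪w, w'⟫_ℂ) :
    Schur.charProjL μT κ (((adelicGroupData (↥(maximalRealSubfield L)) L (IsCMField.complexConj L) N H).rightRegular ν).restrict kT) hκ hκu hU hUu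
        ((adelicGroupData (↥(maximalRealSubfield L)) L (IsCMField.complexConj L) N H).rightRegular ν k
          (MemLp.toLp _ (memLp_toQuotFun_lineThetaLift L N H e₁ dV hdV hdV0 ιA hιA μ hμ a hρ μW
          (piSchwartzBruhatEquiv (↥(maximalRealSubfield L)) (Fin n') ((follandHermite (frameV L e₁ dV hdV hdV0 (lineW L (TW (Fp L) a)) (complexConj_lineW L (TW (Fp L) a)) (lineW_ne_zero L (TW (Fp L) a) (isUnit_det_TW (Fp L) a))) β) ⊗ₜ Φf)) f ν 2))) =
      (((((etaD L e₁ dV hdV (lineW L (TW (Fp L) a)) (complexConj_lineW L (TW (Fp L) a)) τ (archKPlace L e₁ dV hdV (lineW L (TW (Fp L) a)) (complexConj_lineW L (TW (Fp L) a)) v₀ u) : ℂˣ) : ℂ)) * c) * hermiteCoeff γ ((schwartzTransport (euclE (Fin n' × {v : InfinitePlace (↥(maximalRealSubfield L)) // v.IsReal}))).symm (schwartzTransport (frameV L e₁ dV hdV hdV0 (lineW L (TW (Fp L) a)) (complexConj_lineW L (TW (Fp L) a)) (lineW_ne_zero L (TW (Fp L) a) (isUnit_det_TW (Fp L) a)))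 φ'))) •
        MemLp.toLp _ (memLp_toQuotFun_lineThetaLift L N H e₁ dV hdV hdV0 ιA hιA μ hμ a hρ μW
          (piSchwartzBruhatEquiv (↥(maximalRealSubfield L)) (Fin n') ((follandHermite (frameV L e₁ dV hdV hdV0 (lineW L (TW (Fp L) a)) (complexConj_lineW L (TW (Fp L) a)) (lineW_ne_zero L (TW (Fp L) a) (isUnit_det_TW (Fp L) a))) γ) ⊗ₜ Φf)) f ν 2) := by
  rw [rightRegular_toLp_lineThetaLift_follandHermite_of_box L N H e₁ dV hdV hdV0 ιA hιA μ hμ a hρ μW f ν v₀ hτ hodd u β hbox k hk Φf,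
    map_smul,
    charProjL_thetaClass_eq_coeff_smul_of_hasSum_thetaClass L N H e₁ dV hdV hdV0 ιA hιA μ hμ a hρ μW f ν hτ hodd γ Φf kT hkT μT hκ hκu hκc hU hUu _ _
      (hasSum_follandCoeff_smul_thetaClass_follandHermite L N H e₁ dV hdV hdV0 ιA hιA μ hμ a hρ μW f ν
        (frameV L e₁ dV hdV hdV0 (lineW L (TW (Fp L) a)) (complexConj_lineW L (TW (Fp L) a)) (lineW_ne_zero L (TW (Fp L) a) (isUnit_det_TW (Fp L) a))) Φf _),
    smul_smul]

set_option maxHeartbeats 1600000 in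
/-- **§3 THE BOX STEP OF THE ARCHIMEDEAN LADDER.**  If `Q ⊆ L²([U(H)], ν)` is a closed `R`-invariant subspace containing the Hermite theta class
`[θ_{h_β ⊗ Φ_f}]`, and for some `u ∈ U(σ_{w₀} diag dV)(ℂ)` at a real place `v₀` Folland's section reads on the first box slot as `c • (φ′ ⊠ ·)` (`hbox`) with
`c ≠ 0` and a non-zero `γ`-th Folland-frame Hermite coefficient `c_γ(φ′) ≠ 0`, then `[θ_{h_γ ⊗ Φ_f}] ∈ Q`: `R(k)` and the projector `P_γ` preserve `Q` (★
`charProj_restrict_mem_closedSubrep`) and `P_γ (R(k) [θ_{h_β ⊗ Φ_f}])` is a NON-ZERO multiple of `[θ_{h_γ ⊗ Φ_f}]` (§2, `η_D(u) ∈ ℂˣ`).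
[cite: Folland1989, Ch. 4 §5; Prop. (4.39)] [cite: KashiwaraVergne1978, §6] [cite: Howe1989, §3] -/
theorem thetaClass_follandHermite_mem_of_box_of_coeff_ne_zero (v₀ : {v : InfinitePlace (↥(maximalRealSubfield L)) // v.IsReal})
    {τ : InfinitePlace L → ℤ} (hτ : (toHeckeCharacter L μ).HasUnitaryArchType τ 0) (hodd : ∀ w, Odd (τ w))
    (u : UnitaryGroup.archLocal L N (Matrix.diagonal dV) (cmPlaceOver L v₀))
    (β γ : (Fin n' × {v : InfinitePlace (↥(maximalRealSubfield L)) // v.IsReal}) →₀ ℕ)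
    {φ' : 𝓢((Fin n' → mixedEmbedding.mixedSpace ↥(maximalRealSubfield L)), ℂ)} {c : ℂ}
    (hbox : carrierConjEquiv (frameD L e₁ dV hdV hdV0 (lineW L (TW (Fp L) a)) (complexConj_lineW L (TW (Fp L) a)) (lineW_ne_zero L (TW (Fp L) a) (isUnit_det_TW (Fp L) a))) (sectionD L e₁ dV hdV hdV0 (lineW L (TW (Fp L) a)) (complexConj_lineW L (TW (Fp L) a)) (lineW_ne_zero L (TW (Fp L) a) (isUnit_det_TW (Fp L) a)) (archKPlace L e₁ dV hdV (lineW L (TW (Fp L) a)) (complexConj_lineW L (TW (Fp L) a)) v₀ u)).1.2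
        (schwartzReindexCLM (Fp L) (e₂ (n := n')) (archBoxTensor (follandHermite (frameV L e₁ dV hdV hdV0 (lineW L (TW (Fp L) a)) (complexConj_lineW L (TW (Fp L) a)) (lineW_ne_zero L (TW (Fp L) a) (isUnit_det_TW (Fp L) a))) β) (follandHermite (frameV L e₁ dV hdV hdV0 (lineW L (TW (Fp L) a)) (complexConj_lineW L (TW (Fp L) a)) (lineW_ne_zero L (TW (Fp L) a) (isUnit_det_TW (Fp L) a))) 0))) =
      c • schwartzReindexCLM (Fp L) (e₂ (n := n')) (archBoxTensor φ' (follandHermite (frameV L e₁ dV hdV hdV0 (lineW L (TW (Fp L) a)) (complexConj_lineW L (TW (Fp L) a)) (lineW_ne_zero L (TW (Fp L) a) (isUnit_det_TW (Fp L) a))) 0)))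
    (hc : c ≠ 0) (hne : hermiteCoeff γ ((schwartzTransport (euclE (Fin n' × {v : InfinitePlace (↥(maximalRealSubfield L)) // v.IsReal}))).symm (schwartzTransport (frameV L e₁ dV hdV hdV0 (lineW L (TW (Fp L) a)) (complexConj_lineW L (TW (Fp L) a)) (lineW_ne_zero L (TW (Fp L) a) (isUnit_det_TW (Fp L) a))) φ')) ≠ 0)
    (k : (adelicGroupData (↥(maximalRealSubfield L)) L (IsCMField.complexConj L) N H).Adelic)
    (hk : ιA k = UnitaryGroup.adelicSingle (↥(maximalRealSubfield L)) L (IsCMField.complexConj L) N (Matrix.diagonal dV) (IsCMField.complexConj_ne_one L)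
      (complexConj_smul_infinitePlace L) (cmPlaceOver L v₀) u)
    (Φf : FinSB (↥(maximalRealSubfield L)) (Fin n'))
    (kT : (({v : InfinitePlace (↥(maximalRealSubfield L)) // v.IsReal}) → Fin N → Circle) →*
      (adelicGroupData (↥(maximalRealSubfield L)) L (IsCMField.complexConj L) N H).Adelic)
    (hkT : ∀ (v : {v : InfinitePlace (↥(maximalRealSubfield L)) // v.IsReal}) (x : Fin N → Circle),
      ιA (kT (Pi.mulSingle v x)) = UnitaryGroup.adelicSingle (↥(maximalRealSubfield L)) L (IsCMField.complexConj L) N (Matrix.diagonal dV)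
        (IsCMField.complexConj_ne_one L) (complexConj_smul_infinitePlace L) (cmPlaceOver L v)
        ⟨circleDiagonal N x, circleDiagonal_mem_archLocal_diagonal L N dV (cmPlaceOver L v) x⟩)
    [MeasurableSpace (({v : InfinitePlace (↥(maximalRealSubfield L)) // v.IsReal}) → Fin N → Circle)] [BorelSpace (({v : InfinitePlace (↥(maximalRealSubfield L)) // v.IsReal}) → Fin N → Circle)]
    (μT : Measure (({v : InfinitePlace (↥(maximalRealSubfield L)) // v.IsReal}) → Fin N → Circle)) [IsProbabilityMeasure μT] [μT.IsMulLeftInvariant]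
    {κ : ContRepresentation ℂ (({v : InfinitePlace (↥(maximalRealSubfield L)) // v.IsReal}) → Fin N → Circle) ℂ}
    (hκ : Continuous (κ : (({v : InfinitePlace (↥(maximalRealSubfield L)) // v.IsReal}) → Fin N → Circle) → ℂ →L[ℂ] ℂ)) [κ.toRepresentation.IsIrreducible]
    (hκu : ∀ (g : (({v : InfinitePlace (↥(maximalRealSubfield L)) // v.IsReal}) → Fin N → Circle)) (x y : ℂ), ⟪κ g x, κ g y⟫_ℂ = ⟪x, y⟫_ℂ)
    (hκc : ∀ z, κ z 1 = (∏ v : {v : InfinitePlace (↥(maximalRealSubfield L)) // v.IsReal}, ∏ p : Fin N, (((z v p : Circle) : ℂ)) ^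
        (if 0 < signVec (cmPlaceOver L) (cmGramEntry L e₁ dV hdV (lineW L (TW (Fp L) a)) (complexConj_lineW L (TW (Fp L) a))) (imagUnit L) v (e₁ (p, 0))
          then (τ (cmPlaceOver L v).1 + 1) / 2 + γ (e₁ (p, 0), v)
          else (τ (cmPlaceOver L v).1 + 1) / 2 - 1 - γ (e₁ (p, 0), v))))
    (hU : ∀ w, Continuous fun z : (({v : InfinitePlace (↥(maximalRealSubfield L)) // v.IsReal}) → Fin N → Circle) => (((adelicGroupData (↥(maximalRealSubfield L)) L (IsCMField.complexConj L) N H).rightRegular ν).restrict kT) z w)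
    (hUu : ∀ (z : (({v : InfinitePlace (↥(maximalRealSubfield L)) // v.IsReal}) → Fin N → Circle)) (w w' : Lp ℂ 2 ν), ⟪(((adelicGroupData (↥(maximalRealSubfield L)) L (IsCMField.complexConj L) N H).rightRegular ν).restrict kT) z w, (((adelicGroupData (↥(maximalRealSubfield L)) L (IsCMField.complexConj L) N H).rightRegular ν).restrict kT) z w'⟫_ℂ = ⟪w, w'⟫_ℂ)
    (Q : ContRepresentation.ClosedSubrep ((adelicGroupData (↥(maximalRealSubfield L)) L (IsCMField.complexConj L) N H).rightRegular ν))
    (hQ : MemLp.toLp _ (memLp_toQuotFun_lineThetaLift L N H e₁ dV hdV hdV0 ιA hιA μ hμ a hρ μW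
          (piSchwartzBruhatEquiv (↥(maximalRealSubfield L)) (Fin n') ((follandHermite (frameV L e₁ dV hdV hdV0 (lineW L (TW (Fp L) a)) (complexConj_lineW L (TW (Fp L) a)) (lineW_ne_zero L (TW (Fp L) a) (isUnit_det_TW (Fp L) a))) β) ⊗ₜ Φf)) f ν 2) ∈ Q) :
    MemLp.toLp _ (memLp_toQuotFun_lineThetaLift L N H e₁ dV hdV hdV0 ιA hιA μ hμ a hρ μW
          (piSchwartzBruhatEquiv (↥(maximalRealSubfield L)) (Fin n') ((follandHermite (frameV L e₁ dV hdV hdV0 (lineW L (TW (Fp L) a)) (complexConj_lineW L (TW (Fp L) a)) (lineW_ne_zero L (TW (Fp L) a) (isUnit_det_TW (Fp L) a))) γ) ⊗ₜ Φf)) f ν 2) ∈ Q := by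
  -- `R(k)` and `P_γ` preserve `Q`
  have h1 := Q.apply_mem k hQ
  have h2 : Schur.charProjL μT κ (((adelicGroupData (↥(maximalRealSubfield L)) L (IsCMField.complexConj L) N H).rightRegular ν).restrict kT) hκ hκu hU hUu
      ((adelicGroupData (↥(maximalRealSubfield L)) L (IsCMField.complexConj L) N H).rightRegular ν k
        (MemLp.toLp _ (memLp_toQuotFun_lineThetaLift L N H e₁ dV hdV hdV0 ιA hιA μ hμ a hρ μW
          (piSchwartzBruhatEquiv (↥(maximalRealSubfield L)) (Fin n') ((follandHermite (frameV L e₁ dV hdV hdV0 (lineW L (TW (Fp L) a)) (complexConj_lineW L (TW (Fp L) a)) (lineW_ne_zero L (TW (Fp L) a) (isUnit_det_TW (Fp L) a))) β) ⊗ₜ Φf)) f ν 2))) ∈ Q := by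
    rw [Schur.charProjL_apply]
    exact charProj_restrict_mem_closedSubrep μT hκ _ kT hU Q h1
  rw [charProjL_rightRegular_thetaClass_follandHermite_of_box L N H e₁ dV hdV hdV0 ιA hιA μ hμ a hρ μW f ν v₀ hτ hodd u β γ hbox k hk Φf kT hkT μT hκ
    hκu hκc hU hUu] at h2
  -- a non-zero multiple
  have hcoef : ((((etaD L e₁ dV hdV (lineW L (TW (Fp L) a)) (complexConj_lineW L (TW (Fp L) a)) τ (archKPlace L e₁ dV hdV (lineW L (TW (Fp L) a)) (complexConj_lineW L (TW (Fp L) a)) v₀ u) : ℂˣ) : ℂ)) * c) * hermiteCoeff γ ((schwartzTransport (euclE (Fin n' × {v : InfinitePlace (↥(maximalRealSubfield L)) // v.IsReal}))).symm (schwartzTransport (frameV L e₁ dV hdV hdV0 (lineW L (TW (Fp L) a)) (complexConj_lineW L (TW (Fp L) a)) (lineW_ne_zero L (TW (Fp L) a) (isUnit_det_TW (Fp L) a))) φ')) ≠ 0 := mul_ne_zero (mul_ne_zero (Units.ne_zero _) hc) hne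
  have h3 := Q.toSubmodule.smul_mem (((((etaD L e₁ dV hdV (lineW L (TW (Fp L) a)) (complexConj_lineW L (TW (Fp L) a)) τ (archKPlace L e₁ dV hdV (lineW L (TW (Fp L) a)) (complexConj_lineW L (TW (Fp L) a)) v₀ u) : ℂˣ) : ℂ)) * c) * hermiteCoeff γ ((schwartzTransport (euclE (Fin n' × {v : InfinitePlace (↥(maximalRealSubfield L)) // v.IsReal}))).symm (schwartzTransport (frameV L e₁ dV hdV hdV0 (lineW L (TW (Fp L) a)) (complexConj_lineW L (TW (Fp L) a)) (lineW_ne_zero L (TW (Fp L) a) (isUnit_det_TW (Fp L) a))) φ')))⁻¹ h2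
  rwa [smul_smul, inv_mul_cancel₀ hcoef, one_smul] at h3

end Covariance

end Summit.HodgeConjecture.HodgeConjecture.Cruxes.HLiu418.F0LD1ThetaArchBoxStep

end
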